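import Literature.NumberTheory.EllipticCurves.MazurTorsionGaloisStructureProofs
import Literature.NumberTheory.EllipticCurves.IsogenyTorsionFreeMemberProofs
import Literature.NumberTheory.EllipticCurves.IsogenyDualProofs
import Literature.NumberTheory.EllipticCurves.IsogenySelmerGroups
import HarnessLib

/-!
# The kernel of the dual of an isogeny with rational cyclic kernel of prime degree is `μ_p`-isotypic
# (Mazur 1977, Ch. III §5, (5.4) `0 → ℤ/p → E[p] → μ_p → 0`, read on the dual isogeny)

PROOF-ONLY file (theorems only, no definition, no named fact, no `sorry`), topic
`NumberTheory/EllipticCurves`. Let `E/F` be an elliptic curve over a perfect field with `p ≠ char F`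
prime, `φ : E → E'` and `ψ : E' → E` isogenies with `ψ ∘ φ = [p]` (e.g. `ψ = φ̂`, Silverman III.6.1).

* §1 (any such pair) `mem_ker_dual_iff`, **`ker_dual_eq_map_geomTorsion`** — `ker ψ = φ(E[p])`
  (`φ` is onto `E'(F̄)`); `nsmul_eq_zero_of_mem_ker_dual` — `ker ψ` is killed by `p`;
  `ker_le_geomTorsion` — `ker φ ⊆ E[p]`.
* §2 (`ker φ ∋ T`, a non-zero `Γ_F`-fixed point of `E[p]` — e.g. `φ = E → E/⟨T⟩` for a rational point
  `T` of order `p`) **`smul_eq_cyclotomic_smul_of_mem_ker_dual`** — `Γ_F` acts on `ker ψ` through the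
  mod-`p` cyclotomic character: `σ Q = χ̄_p(σ) Q` for `Q ∈ ker ψ` (Mazur's (5.4): `σS − χ̄_p(σ)S ∈ ⟨T⟩` on
  `E[p]`, tree `smul_sub_cyclotomic_smul_mem_zmultiples`, pushed through `φ`, which kills `⟨T⟩`). So
  `ker ψ ⊆ E'(F̄)` is a `μ_p`-ISOTYPIC Galois module: when `#ker ψ = p` it is `≅ μ_p`, and the
  `ψ`-Selmer group lives in `H¹(F, μ_p) = Fˣ/Fˣᵖ` (Kummer theory) — the «`μ_p`-side» of the
  `p`-isogeny descent (Silverman X.4.9 for `p = 2`; Fisher 2001 §1 for `p = 5, 7`).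
* §3 (over `ℚ`, `p` odd) **`eq_zero_of_mem_ker_dual_of_forall_smul_eq`** — `ker ψ` has NO non-zero
  rational point (a complex conjugation has `χ̄_p = −1 ≠ 1`; tree
  `Isogeny.apply_eq_zero_of_forall_smul_apply_eq`); **`ratKerCard_dual_eq_one`** — `#E'[ψ](ℚ) = 1`,
  the numerator `#E'(ℚ)[φ̂]` of Cassels' formula for such a pair.
* §4 `natCard_ker_dual` — if `#ker φ = p` then `#ker ψ = p` (`#E[p] = p²`, `ker ψ ≅ E[p]/ker φ`).

## References

* [Mazur1977] B. Mazur, *Modular curves and the Eisenstein ideal*, Publ. Math. IHÉS 47 (1977), Ch. III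
  §5, (5.4), p. 157.
* [SilvermanAEC2009] J. H. Silverman, *The Arithmetic of Elliptic Curves*, 2nd ed., Thm. III.6.1–6.2,
  Cor. III.6.4(b), III.8.1, Prop. X.4.9, Exercise 10.1.
* [Fisher2001FiveSevenDescent] T. Fisher, *Some examples of 5 and 7 descent for elliptic curves over ℚ*,
  JEMS 3 (2001), §1.

## Design

Theorems only; conventions of `MazurTorsionGaloisStructureProofs` (`F : Type u`, `open scoped Classical`,
the mod-`p` cyclotomic character `Literature.NumberTheory.GaloisRepresentations.modPCyclotomicCharacterZMod`,
`ℕ`-multiples `(χ̄_p σ).val • Q` in statements).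
-/

noncomputable section

open scoped Classical

universe u

namespace WeierstrassCurve.Isogeny

open Literature.NumberTheory.EllipticCurves Literature.NumberTheory.GaloisRepresentations Field

/-! ## §1 `ker ψ = φ(E[p])` for `ψ ∘ φ = [p]` -/

section Kernel

variable {F : Type u} [Field F] {W W' : WeierstrassCurve F} [W.IsElliptic] [W'.IsElliptic]
  (φ : Isogeny W W') (ψ : Isogeny W' W) {p : ℕ} (h : ∀ P, ψ (φ P) = (p : ℤ) • P)

include h

/-- **`ker ψ = φ(E[p])`** for isogenies `φ : E → E'`, `ψ : E' → E` with `ψ ∘ φ = [p]`: a point `Q ∈ E'(F̄)`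
is killed by `ψ` iff `Q = φ(S)` with `pS = O` (`⟸`: `ψφS = pS = O`; `⟹`: `Q = φ(S)` as `φ` is onto
`E'(F̄)`, and `pS = ψφS = ψQ = O`). [cite: SilvermanAEC2009, Thm. III.6.1(a) and Thm. II.2.3] -/
theorem mem_ker_dual_iff (Q : W'.geomPoints) :
    Q ∈ ψ.toAddMonoidHom.ker ↔ ∃ S : W.geomPoints, S ∈ geomTorsion W (p : ℤ) ∧ φ S = Q := by
  constructor
  · intro hQ
    obtain ⟨S, rfl⟩ := φ.surjective Q
    refine ⟨S, ?_, rfl⟩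
    rw [AddSubgroup.torsionBy.nsmul_iff, ← natCast_zsmul, ← h S]
    exact hQ
  · rintro ⟨S, hS, rfl⟩
    rw [AddMonoidHom.mem_ker, coe_toAddMonoidHom, h S, natCast_zsmul]
    exact AddSubgroup.torsionBy.nsmul_iff.mp hS

/-- **`ker ψ = φ(E[p])`** as subgroups of `E'(F̄)`. [cite: SilvermanAEC2009, Thm. III.6.1(a)] -/
theorem ker_dual_eq_map_geomTorsion :
    ψ.toAddMonoidHom.ker = (geomTorsion W (p : ℤ)).map φ.toAddMonoidHom := by
  ext Q
  rw [mem_ker_dual_iff φ ψ h, AddSubgroup.mem_map]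
  simp only [coe_toAddMonoidHom]

/-- `ker ψ` is killed by `p` (`Q = φS`, `pQ = φ(pS) = O`). [cite: SilvermanAEC2009, Thm. III.6.2(e)] -/
theorem nsmul_eq_zero_of_mem_ker_dual {Q : W'.geomPoints} (hQ : Q ∈ ψ.toAddMonoidHom.ker) : p • Q = 0 := by
  obtain ⟨S, hS, rfl⟩ := (mem_ker_dual_iff φ ψ h Q).mp hQ
  rw [← map_nsmul, AddSubgroup.torsionBy.nsmul_iff.mp hS, map_zero]

omit [W.IsElliptic] [W'.IsElliptic] in
/-- `ker φ ⊆ E[p]` (`pP = ψφP = ψO = O`). [cite: SilvermanAEC2009, Thm. III.6.2(e)] -/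
theorem ker_le_geomTorsion : φ.toAddMonoidHom.ker ≤ geomTorsion W (p : ℤ) := by
  intro P hP
  rw [AddSubgroup.torsionBy.nsmul_iff, ← natCast_zsmul, ← h P]
  rw [AddMonoidHom.mem_ker, coe_toAddMonoidHom] at hP
  rw [hP, map_zero]

end Kernel

/-! ## §2 `Γ_F` acts on `ker ψ` through the mod-`p` cyclotomic character -/

section Cyclotomic

variable {F : Type u} [Field F] [PerfectField F] {W W' : WeierstrassCurve F} [W.IsElliptic] [W'.IsElliptic]
  (φ : Isogeny W W') (ψ : Isogeny W' W) {p : ℕ} [Fact p.Prime] [NeZero (p : F)]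
  (h : ∀ P, ψ (φ P) = (p : ℤ) • P)

include h

/-- **Mazur's (5.4) on the dual kernel: `σ Q = χ̄_p(σ) Q` for `Q ∈ ker ψ`**, when `ker φ` contains a
non-zero `Γ_F`-fixed point `T` of `E[p]` (the kernel of `E → E/⟨T⟩` for a rational point `T` of order `p`).
Proof: `Q = φ(S)`, `S ∈ E[p]`; by (5.4) `σS − χ̄_p(σ)S ∈ ⟨T⟩` (tree `smul_sub_cyclotomic_smul_mem_zmultiples`,
from `det ρ̄_{E,p} = χ̄_p` and the Weil pairing), and `φ` kills `⟨T⟩` and commutes with `σ`. Thus `ker ψ` is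
`μ_p`-isotypic («`E'[φ̂] ≅ μ_p`»). [cite: Mazur1977, Ch. III §5, (5.4), p. 157] -/
theorem smul_eq_cyclotomic_smul_of_mem_ker_dual {T : geomTorsion W (p : ℤ)} (hT0 : T ≠ 0)
    (hTfix : ∀ σ : absoluteGaloisGroup F, σ • T = T) (hTker : φ (T : W.geomPoints) = 0)
    (σ : absoluteGaloisGroup F) {Q : W'.geomPoints} (hQ : Q ∈ ψ.toAddMonoidHom.ker) :
    σ • Q = ((modPCyclotomicCharacterZMod F p σ : (ZMod p)ˣ) : ZMod p).val • Q := by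
  obtain ⟨S, hS, rfl⟩ := (mem_ker_dual_iff φ ψ h Q).mp hQ
  set v : ℕ := ((modPCyclotomicCharacterZMod F p σ : (ZMod p)ˣ) : ZMod p).val with hv
  -- (5.4): `σ • S - v • S ∈ ⟨T⟩` in `E[p]`
  obtain ⟨k, hk⟩ := AddSubgroup.mem_zmultiples_iff.mp
    (smul_sub_cyclotomic_smul_mem_zmultiples W p hT0 hTfix σ ⟨S, hS⟩)
  have hk' : k • (T : W.geomPoints) = σ • S - v • S := by
    have e := congrArg Subtype.val hk
    simpa only [AddSubgroupClass.coe_zsmul, AddSubgroupClass.coe_sub, AddSubgroupClass.coe_nsmul,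
      AddSubgroup.torsionBy.coe_smul] using e
  -- apply `φ`, which kills `T` and commutes with `σ`
  have h1 : φ (k • (T : W.geomPoints)) = 0 := by rw [map_zsmul, hTker, zsmul_zero]
  rw [hk', map_sub, map_nsmul, sub_eq_zero, Isogeny.map_smul] at h1
  exact h1

/-- The same with the character value `1`: `σ` fixes `ker ψ` pointwise when `χ̄_p(σ) = 1` (e.g. on
`Γ_{F(ζ_p)}`): `ker ψ` becomes CONSTANT over `F(μ_p)`. [cite: Mazur1977, Ch. III §5, p. 157] -/
theorem smul_eq_of_mem_ker_dual_of_cyclotomic_eq_one {T : geomTorsion W (p : ℤ)} (hT0 : T ≠ 0)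
    (hTfix : ∀ σ : absoluteGaloisGroup F, σ • T = T) (hTker : φ (T : W.geomPoints) = 0)
    {σ : absoluteGaloisGroup F} (hσ : modPCyclotomicCharacterZMod F p σ = 1) {Q : W'.geomPoints}
    (hQ : Q ∈ ψ.toAddMonoidHom.ker) : σ • Q = Q := by
  rw [smul_eq_cyclotomic_smul_of_mem_ker_dual φ ψ h hT0 hTfix hTker σ hQ, hσ, Units.val_one,
    ZMod.val_one, one_smul]

end Cyclotomic

/-! ## §3 Over `ℚ`, `p` odd: `ker ψ` has no non-zero rational point -/

section Rat

variable {W W' : WeierstrassCurve ℚ} [W.IsElliptic] [W'.IsElliptic] (φ : Isogeny W W') (ψ : Isogeny W' W)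
  {p : ℕ} [Fact p.Prime] (h : ∀ P, ψ (φ P) = (p : ℤ) • P)

include h

/-- **No rational point in the dual kernel** (`ℚ`, `p` odd): if `ker φ ∋ T ≠ O` with `T` fixed by `Γ_ℚ`,
then a `Γ_ℚ`-fixed `Q ∈ ker ψ` is `O` — a complex conjugation `c` has `χ̄_p(c) = −1 ≠ 1`, so `Q = −Q`,
and `pQ = O` with `p` odd (tree `Isogeny.apply_eq_zero_of_forall_smul_apply_eq`). In Cassels' notation
`E'(ℚ)[φ̂] = 0`. [cite: Mazur1977, Ch. III §5, (5.4), p. 157] -/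
theorem eq_zero_of_mem_ker_dual_of_forall_smul_eq (hp2 : p ≠ 2) {T : geomTorsion W (p : ℤ)}
    (hT0 : T ≠ 0) (hTfix : ∀ σ : absoluteGaloisGroup ℚ, σ • T = T) (hTker : φ (T : W.geomPoints) = 0)
    {Q : W'.geomPoints} (hQ : Q ∈ ψ.toAddMonoidHom.ker) (hQfix : ∀ σ : absoluteGaloisGroup ℚ, σ • Q = Q) :
    Q = 0 := by
  obtain ⟨S, hS, rfl⟩ := (mem_ker_dual_iff φ ψ h Q).mp hQ
  exact Isogeny.apply_eq_zero_of_forall_smul_apply_eq W p hp2 φ hT0 hTfix hTker ⟨S, hS⟩ hQfix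

/-- **`#E'[ψ](ℚ) = 1`**: the only rational point of `ker ψ` is `O` (the tree's `Isogeny.ratKerCard`, the
factor `#E'(ℚ)[φ̂]` of Cassels' formula `#Sel^φ/#Sel^φ̂ = (#E(ℚ)[φ]/#E'(ℚ)[φ̂]) · Ω_{E'}/Ω_E · ∏ c_v(E')/c_v(E)`).
[cite: Mazur1977, Ch. III §5, (5.4), p. 157] -/
theorem ratKerCard_dual_eq_one (hp2 : p ≠ 2) {T : geomTorsion W (p : ℤ)} (hT0 : T ≠ 0)
    (hTfix : ∀ σ : absoluteGaloisGroup ℚ, σ • T = T) (hTker : φ (T : W.geomPoints) = 0) :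
    ψ.ratKerCard = 1 := by
  unfold ratKerCard
  haveI : Subsingleton {P : W'.geomPoints // ψ P = 0 ∧ ∀ σ : absoluteGaloisGroup ℚ, σ • P = P} :=
    ⟨fun P Q ↦ Subtype.ext <| by
      rw [eq_zero_of_mem_ker_dual_of_forall_smul_eq φ ψ h hp2 hT0 hTfix hTker P.2.1 P.2.2,
        eq_zero_of_mem_ker_dual_of_forall_smul_eq φ ψ h hp2 hT0 hTfix hTker Q.2.1 Q.2.2]⟩
  haveI : Nonempty {P : W'.geomPoints // ψ P = 0 ∧ ∀ σ : absoluteGaloisGroup ℚ, σ • P = P} :=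
    ⟨⟨0, map_zero ψ, fun σ ↦ smul_zero σ⟩⟩
  exact Nat.card_unique

end Rat

/-! ## §4 `#ker ψ = p` when `#ker φ = p` -/

section Card

variable {F : Type u} [Field F] {W W' : WeierstrassCurve F} [W.IsElliptic] [W'.IsElliptic]
  (φ : Isogeny W W') (ψ : Isogeny W' W) {p : ℕ} [Fact p.Prime] [NeZero (p : F)]
  (h : ∀ P, ψ (φ P) = (p : ℤ) • P)

include h

/-- **`#ker ψ = p` when `#ker φ = p`**: `φ` restricted to `E[p]` maps onto `ker ψ` (§1) with kernel
`ker φ ⊆ E[p]`, and `#E[p] = p²` (Silverman III.6.4(b), tree `natCard_geomTorsion`). So `deg φ̂ = deg φ`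
for a `p`-isogeny, in the tree's kernel-counting currency. [cite: SilvermanAEC2009, Thm. III.6.2(e) and Cor. III.6.4(b)] -/
theorem natCard_ker_dual (hφ : Nat.card φ.toAddMonoidHom.ker = p) : Nat.card ψ.toAddMonoidHom.ker = p := by
  have hp : p.Prime := Fact.out
  -- `φ` restricted to `E[p]`, with values in `ker ψ`
  set Tp : AddSubgroup W.geomPoints := geomTorsion W (p : ℤ) with hTp
  have hmem : ∀ S : Tp, φ (S : W.geomPoints) ∈ ψ.toAddMonoidHom.ker := fun S ↦
    (mem_ker_dual_iff φ ψ h _).mpr ⟨S, S.2, rfl⟩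
  let r : Tp →+ ψ.toAddMonoidHom.ker :=
    { toFun := fun S ↦ ⟨φ (S : W.geomPoints), hmem S⟩
      map_zero' := Subtype.ext (by simp)
      map_add' := fun S S' ↦ Subtype.ext (by simp) }
  have hr_surj : Function.Surjective r := by
    rintro ⟨Q, hQ⟩
    obtain ⟨S, hS, rfl⟩ := (mem_ker_dual_iff φ ψ h Q).mp hQ
    exact ⟨⟨S, hS⟩, rfl⟩
  -- its kernel is `ker φ` (seen inside `E[p]`), of order `p`
  have hker_card : Nat.card r.ker = p := by
    rw [← hφ]
    refine Nat.card_congr ⟨fun S ↦ ⟨(S.1 : W.geomPoints), ?_⟩, fun P ↦ ⟨⟨P.1, ker_le_geomTorsion φ ψ h P.2⟩, ?_⟩,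
      fun S ↦ rfl, fun P ↦ rfl⟩
    · have hS := S.2
      rw [AddMonoidHom.mem_ker] at hS
      rw [AddMonoidHom.mem_ker, coe_toAddMonoidHom]
      exact congrArg Subtype.val hS
    · have hP := P.2
      rw [AddMonoidHom.mem_ker, coe_toAddMonoidHom] at hP
      rw [AddMonoidHom.mem_ker]
      exact Subtype.ext hP
  -- count: `p² = #E[p] = #ker r · #im r = p · #ker ψ`
  have hTp_card : Nat.card Tp = p ^ 2 := natCard_geomTorsion W p
  have hquot : Nat.card Tp = Nat.card (Tp ⧸ r.ker) * Nat.card r.ker :=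
    AddSubgroup.card_eq_card_quotient_mul_card_addSubgroup r.ker
  have hrange : Nat.card (Tp ⧸ r.ker) = Nat.card ψ.toAddMonoidHom.ker := by
    rw [Nat.card_congr (QuotientAddGroup.quotientKerEquivRange r).toEquiv,
      AddMonoidHom.range_eq_top.mpr hr_surj, AddSubgroup.card_top]
  rw [hTp_card, hker_card, hrange, pow_two] at hquot
  exact (Nat.eq_of_mul_eq_mul_right hp.pos hquot).symm

end Card

end WeierstrassCurve.Isogeny

end
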